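import Mathlib
import HarnessLib
import Summits.HubbardSuperconductivity.HubbardSuperconductivity.Theorems.KLProgrammeKLRegimeEngineTowerLevBaseFWgridTok
import Summits.HubbardSuperconductivity.HubbardSuperconductivity.Theorems.KLProgrammeKLRegimeEngineTowerLevStepLinkUniformFKlEng
import Summits.HubbardSuperconductivity.HubbardSuperconductivity.Theorems.KLProgrammeKLRegimeEngineTowerLevZSuccOfBlockBounds
import Summits.HubbardSuperconductivity.HubbardSuperconductivity.Theorems.KLProgrammeKLRegimeEngineTowerLevZBaseOfWgridStep

/-!
# Route `KLProgramme` — crux K3 ENGINE (stmt-HubbardSuperconductivity-20437), stub (b) v2, THE LEVELS PACKAGE (ℓ): «(ℓ)-Z-THREAD» (#17/#18), the p4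
# half — the floor-keyed levelled law of the re-based tower, step read from the oriented floor link, WITH NO PARTITION-FUNCTION HYPOTHESIS: the invariant
# `Z^{K}_{Λ_{dk}} ≠ 0` is THREADED through the induction and EXPORTED (cell gate-hubbard-kl, seat p4 g20; `…TowerLevBaseFWgridTok.
# klTowerBLevF_le_law_lev_of_doors_of_wgridStep_tok` (k3c3-p2 g16) ∘ { `…TowerLevStepLinkUniformFKlEng.levLawF_hstep_of_blockBounds_tok` (k3c2-p3 g14),
# `…TowerLevZSuccOfBlockBounds.towerZ_succ_of_blockBounds` (k3c2-p3 g14), `…TowerLevZBaseOfWgridStep.hubbardEffPartitionFnCT_klScale_ne_zero_of_wgridStep` (k3c3-p2 g16) })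

`klTowerBLevF_le_law_lev_of_blocks` (`…TowerLevLawFOfBlocks`, this seat) carried the partition function `Z^{K}_{Λ_{dk}} ≠ 0` of EVERY block `1 ≤ k < Kb` as a
blanket hypothesis.  k3c3-p2 g16 located (#17, after p5 g13's #18) that no consumer can supply it for `k ≥ 2`: it is the induction's own invariant —
`Z_{Λ_{dk}} ≠ 0` ⇒ (law guard of block `k`) ⇒ `Z_{Λ_{d(k+1)}} ≠ 0`.  Here the SAME composition as `…_of_blocks` runs on the TOKENISED assembly (token
`Zk k := Z^{K}_{Λ_{dk}} ≠ 0`): the base value `Zk 1` comes from the base weighted grid step's own data (Gram `κ`, weighted rows `≤ α_w`, guard `θ < 1` — binders the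
law already has), the Z-step `Zk k → Φ·V_k < 1 → Zk (k+1)` and the tokenised floor step both come from the per-block link data the law already has.  Net effect
on the binder list: the line `∀ k, 1 ≤ k < Kb → Z^{K}_{Λ_{dk}} ≠ 0` is GONE and the conclusion gains `∀ k, 1 ≤ k ≤ Kb → Z^{K}_{Λ_{dk}} ≠ 0`.

Composition of landed theorems only; nothing about the model is asserted beyond them; nothing asserts (ℓ), any stub, K3 or superconductivity.
References: BGM 2006 §2.8 (2.76)–(2.84), (2.93)–(2.98), §3 (3.2)–(3.8) [cite: BenfattoGiulianiMastropietro2006].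
-/

noncomputable section

namespace Summit.HubbardSuperconductivity.HubbardSuperconductivity.Theorems.EngineV8

set_option linter.dupNamespace false -- summit = problem name (single-conjunct summit), D-0017

open Classical
open Real Finset Literature.MathematicalPhysics.QuantumLattice Literature.Probability.LatticeModels GrassmannAlgebra
open Literature.Probability.LatticeModels.BattleFederbush
open Literature.MathematicalPhysics.QuantumLattice.FermiRG
open Summit.HubbardSuperconductivity.HubbardSuperconductivity.Theorems.KLProgrammeLegKernels
open Summit.HubbardSuperconductivity.HubbardSuperconductivity.Theorems.KLRegimeSplit
open Summit.HubbardSuperconductivity.HubbardSuperconductivity.Theorems.KLRegimeWick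
open Summit.HubbardSuperconductivity.HubbardSuperconductivity.Theorems.TorusFourierL2
open Summit.HubbardSuperconductivity.HubbardSuperconductivity.Theorems.DispersionFlow

variable {L M : ℕ} [NeZero L] [NeZero M]

/-- **THE FLOOR-KEYED RE-BASED LEVELLED TOWER LAW WITH NO PARTITION-FUNCTION HYPOTHESIS, THE INVARIANT `Z ≠ 0` EXPORTED** («(ℓ)-Z-THREAD»,
#17/#18, p4 half): the binder list of `klTowerBLevF_le_law_lev_of_blocks` with the blanket per-block hypothesis `∀ k, 1 ≤ k < Kb → Z^{K}_{Λ_{dk}} ≠ 0` DELETED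
and nothing put in its place; the conclusion GAINS `∀ k, 1 ≤ k ≤ Kb → Z^{K}_{Λ_{dk}} ≠ 0`.  Composition: k3c3-p2's tokenised assembly
`klTowerBLevF_le_law_lev_of_doors_of_wgridStep_tok` at the token `Zk k := (Z^{K}_{Λ_{dk}} ≠ 0)`, with `Zk 1` from the base weighted grid step
(`hubbardEffPartitionFnCT_klScale_ne_zero_of_wgridStep`, k3c3-p2), the Z-step from the link data (`towerZ_succ_of_blockBounds`, k3c2-p3) and the tokenised
floor step from the same link data (`levLawF_hstep_of_blockBounds_tok`, k3c2-p3).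
[cite: BenfattoGiulianiMastropietro2006, §2.8 (2.83), (2.93)-(2.98), §3 (3.2)-(3.8)] -/
theorem klTowerBLevF_le_law_lev_of_blocks_Z :
    ∃ C₁ C₂ : ℝ, 0 < C₁ ∧ 0 < C₂ ∧ ∀ R : RenConsts, R.WF2 → ∃ c₃' : ℝ, 0 < c₃' ∧ ∃ U₀' : ℝ, 0 < U₀' ∧
      ∀ (P : SplitConsts) (c : ℝ), P.WF → 0 < c → c ≤ klEngC₃6 P R → c ≤ c₃' →
      ∀ μ ∈ klWindowC, ∀ U : ℝ, 0 < U → U ≤ klEngU₀9 P R c → U ≤ U₀' → ∀ β : ℝ, klBetaMin ≤ β → β ≤ Real.exp (c / U ^ 2) →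
      ∀ K : TrigPolyC4v, FrameOK R U (nScales β) μ K → ∀ (L M : ℕ) [NeZero L] [NeZero M],
      klEngL₃ β U ≤ L → klEngM₃ β U L ≤ M → ∀ d Kb D : ℕ, 2 ≤ d → d * Kb - 1 ≤ nScales β + 1 → 3 ≤ D →
      ∀ (cc : ℝ) (n j : ℕ), IsKLRegime U cc (-(n : ℤ)) → j ≤ n →
      ∀ (B : ℝ), 1 ≤ B →
      -- p3's weighted grid step hypotheses at the cutoff `Λ_d`, analysis family `F_{d−1}`, rate `jw`
      ∀ (jw : ℕ) (κ : ℝ), 0 < κ →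
        IsGramBoundedR ((hubbardGridSub L M β (2 * (2 * M))).transpose * hubbardCovAboveCT L M β μ 0 K (klScale klE0 d) *
          hubbardGridSub L M β (2 * (2 * M))) κ →
      ∀ (αw : ℝ), 0 < αw →
        (∀ X, ∑ Y, ‖((hubbardGridSub L M β (2 * (2 * M))).transpose * hubbardCovAboveCT L M β μ 0 K (klScale klE0 d) *
          hubbardGridSub L M β (2 * (2 * M))) X Y‖ * gridLabelWt L (2 * (2 * M)) β {gridLegPos X, gridLegPos Y} ≤ αw) →
        (∀ Y, ∑ X, ‖((hubbardGridSub L M β (2 * (2 * M))).transpose * hubbardCovAboveCT L M β μ 0 K (klScale klE0 d) *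
          hubbardGridSub L M β (2 * (2 * M))) X Y‖ * gridLabelWt L (2 * (2 * M)) β {gridLegPos X, gridLegPos Y} ≤ αw) →
      ∀ (ρ : ℝ), 0 < ρ →
        Real.exp 1 * αw * normV (GridLeg (GridPoint L (2 * (2 * M)))) κ ρ
          (fun m' : ℕ => if m' = 1 then |β| / (2 * (2 * M) : ℕ) * ∑ z : TorusSite 2 L, ‖framePosKernel L K z‖ * (1 + torusSiteDist z 0)
            else if m' = 2 then |U| * |β| / (2 * (2 * M) : ℕ) else 0) / κ ^ 2 < 1 →
      ∀ (crw ccw : ℝ), 0 < crw → 0 < ccw →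
        (∀ X'' : SpaceTimeIdx L M × SectorLeg (sectorCount (d - 1)), ∑ X' : GridLeg (GridPoint L (2 * (2 * M))),
          ‖(sectorAnalysisMatrix L M β (klAnisoFamily L M β μ K klE0 (d - 1)) * hubbardGridSub L M β (2 * (2 * M))) X'' X'‖ *
            gridLabelWt L (2 * (2 * M)) β {latticeLegPos (2 * (2 * M)) X'', gridLegPos X'} ≤ crw) →
        (∀ X' : GridLeg (GridPoint L (2 * (2 * M))), ∑ X'' : SpaceTimeIdx L M × SectorLeg (sectorCount (d - 1)),
          ‖(sectorAnalysisMatrix L M β (klAnisoFamily L M β μ K klE0 (d - 1)) * hubbardGridSub L M β (2 * (2 * M))) X'' X'‖ *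
            gridLabelWt L (2 * (2 * M)) β {latticeLegPos (2 * (2 * M)) X'', gridLegPos X'} ≤ ccw) →
      -- the derived base constants (equational binders)
      ∀ (nV cF cg Ag Pg : ℝ),
        nV = normV (GridLeg (GridPoint L (2 * (2 * M)))) κ ρ
          (fun m' : ℕ => if m' = 1 then |β| / (2 * (2 * M) : ℕ) * ∑ z : TorusSite 2 L, ‖framePosKernel L K z‖ * (1 + torusSiteDist z 0)
            else if m' = 2 then |U| * |β| / (2 * (2 * M) : ℕ) else 0) →
        cF = (Real.exp 2 * (κ + ρ)) ^ (2 * 2) * (|β| / (2 * (2 * M) : ℕ)) → cg = Real.exp 1 * αw * cF / κ ^ 2 →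
        Ag = crw * Real.exp 1 * cF / (ccw * cg ^ 2) → Pg = ccw ^ 2 * cg / (ρ ^ 2 * (1 - Real.exp 1 * αw * nV / κ ^ 2)) →
      ∀ (ι₂ X : ℝ), 0 ≤ ι₂ → 0 ≤ X →
      ∀ (Ab Qb Ab' ι₂' X' : ℝ), Ab = (2 : ℝ) ^ (7 * (d - 1)) * Ag / P.Klam ^ 2 → Qb = Pg / (8 : ℝ) ^ (d - 1) →
        Ab' = Ab / B ^ 2 → ι₂' = ι₂ / B → X' = X / B ^ 2 →
      -- the floor LINK data («(ℓ)-LINK-UNIFORM-F», k3c2-p3 g14): per-block Gram, decay and analysis-overlap rows at k-free bounds (NO partition function)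
      ∀ (κb αb crb ccb : ℝ), 0 < κb → 0 < αb → 0 < crb → 0 < ccb →
      ∀ (κl αl : ℕ → ℝ), (∀ k, 1 ≤ k → k < Kb → 0 < κl k) → (∀ k, 1 ≤ k → k < Kb → κl k ^ 2 * (8 : ℝ) ^ (d * k) ≤ κb ^ 2) →
      (∀ k, 1 ≤ k → k < Kb → αl k ≤ αb * (4 : ℝ) ^ (d * k)) →
      (∀ k, 1 ≤ k → k < Kb → IsGramBoundedR ((sectorSubMatrix L M β (bgmFatMultiplier L M klE0 β (nambuXiCT L μ K) (d * k - 1))).transpose *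
        hubbardCovSliceCT L M β μ 0 K (klScale klE0 (d * (k + 1))) (klScale klE0 (d * k)) *
          sectorSubMatrix L M β (bgmFatMultiplier L M klE0 β (nambuXiCT L μ K) (d * k - 1))) (κl k)) →
      (∀ k, 1 ≤ k → k < Kb → ∀ X, ∑ Y, ‖((sectorSubMatrix L M β (bgmFatMultiplier L M klE0 β (nambuXiCT L μ K) (d * k - 1))).transpose *
        hubbardCovSliceCT L M β μ 0 K (klScale klE0 (d * (k + 1))) (klScale klE0 (d * k)) *
          sectorSubMatrix L M β (bgmFatMultiplier L M klE0 β (nambuXiCT L μ K) (d * k - 1))) X Y‖ ≤ αl k) →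
      (∀ k, 1 ≤ k → k < Kb → ∀ Y, ∑ X, ‖((sectorSubMatrix L M β (bgmFatMultiplier L M klE0 β (nambuXiCT L μ K) (d * k - 1))).transpose *
        hubbardCovSliceCT L M β μ 0 K (klScale klE0 (d * (k + 1))) (klScale klE0 (d * k)) *
          sectorSubMatrix L M β (bgmFatMultiplier L M klE0 β (nambuXiCT L μ K) (d * k - 1))) X Y‖ ≤ αl k) →
      (∀ k, 1 ≤ k → k < Kb → ∀ X'', ∑ X', ‖(sectorAnalysisMatrix L M β (klAnisoFamily L M β μ K klE0 (d * k)) *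
        sectorSubMatrix L M β (bgmFatMultiplier L M klE0 β (nambuXiCT L μ K) (d * k - 1))) X'' X'‖ ≤ crb) →
      (∀ k, 1 ≤ k → k < Kb → ∀ X', ∑ X'', ‖(sectorAnalysisMatrix L M β (klAnisoFamily L M β μ K klE0 (d * k)) *
        sectorSubMatrix L M β (bgmFatMultiplier L M klE0 β (nambuXiCT L μ K) (d * k - 1))) X'' X'‖ ≤ ccb) →
      (∀ k, 1 ≤ k → k < Kb → Fintype.card (SpaceTimeIdx L M × SectorLeg (sectorCount (d * k - 1))) / 2 ≤ D) →
      -- the law's six names PINNED by the link (equational binders), and the import `ι₁`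
      ∀ (W Z σ Φ ψ τ ι₁ : ℝ), W = 64 * (27 : ℝ) ^ 4 * exp 2 * crb / ccb → Z = exp 4 * ccb ^ 2 * imagTimeWeight β M ^ 2 / 8 →
        σ = κb ^ 2 / (exp 4 * ccb ^ 2) → Φ = 9 * αb * ccb / ((27 : ℝ) ^ 5 * exp 1 * κb ^ 2 * crb) → ψ = exp 4 * ccb ^ 2 / κb ^ 2 →
        τ = exp 2 * κb ^ 2 / ccb ^ 2 → 0 ≤ ι₁ →
      ∀ (ρk Q' Q κA Yb Y A A' ι₃ : ℝ), ρk = max 4 (2 * τ * ψ) → Q' = Z * Qb + 1 → Q = ρk * Q' →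
        κA = W * ((27 : ℝ) ^ 5 * (C₁ / C₂) * (8 : ℝ) ^ (d - 1)) →
        Yb = ι₂ / (2 * Q') + W * Z ^ 3 * X / (4 * Q' ^ 2) + (W * (27 : ℝ) ^ 5 * Ab + κA * Ab) * Q' / 2 →
        Y = ι₂' / (2 * Q') + W * Z ^ 3 * X' / (4 * Q' ^ 2) + (W * (27 : ℝ) ^ 5 * Ab' + κA * Ab') * Q' / 2 →
        A = 2 * Y * (1 - ((2 : ℝ) ^ d)⁻¹) / (κA * Q') →
        A' = (W * (27 : ℝ) ^ 5 * Ab' + κA * Ab') + 2 * Y / Q' → ι₃ = W * Z ^ 3 * X' + A' * Q' ^ 3 →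
      max 1 Z * C₂ ^ 2 * max 4 (2 * τ * ψ) ≤ (2 : ℝ) ^ (d - 1) →
      max 1 (max (8 * Φ * τ * Yb) (128 * exp 1 * ψ ^ 3 * τ ^ 4 * Φ * κA * Yb / ((1 - ((2 : ℝ) ^ d)⁻¹) * ρk ^ 3))) ≤ B →
      (∀ k, 1 ≤ k → k < Kb → W * Z ^ 1 * klTowerMuLevF L M β U μ K d k 1 ≤ ι₁ * (B * epsCoupling P U j)) →
      (∀ k, 1 ≤ k → k < Kb → W * Z ^ 2 * klTowerMuLevF L M β U μ K d k 2 ≤ ι₂' * (B * epsCoupling P U j)) →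
      (∀ k, 2 ≤ k → k < Kb → klTowerMuLevAtF L M β U μ K d 0 k 3 ≤ X' * (B * epsCoupling P U j) ^ 2) →
      U ≤ min 1 (min (1 / (8 * σ * Q' + 1)) (min (1 / (2 * exp 1 * τ * Q' + 1)) (min (1 / (4 * Φ * τ * ι₁ + 1))
        (min (1 / (2 * (Φ * (exp 1 * τ * ι₁ + (exp 1 * τ) ^ 2 * ι₂' + (exp 1 * τ) ^ 3 * ι₃ + A' * (exp 1 * τ * Q') ^ 2 / 2)) + 1))
          (min (A * Q ^ 3 / (16 * σ * Q' * A' * (4 * Q') ^ 3 + A * Q ^ 3))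
            (A * Q ^ 3 / (16 * exp 1 * ψ * (2 * τ * ψ * Q') ^ 2 * Φ * τ ^ 2 * ι₁ ^ 2 + A * Q ^ 3))))))) / (2 * B * P.Klam + 1) →
      cc ≤ min 1 (min (1 / (8 * σ * Q' + 1)) (min (1 / (2 * exp 1 * τ * Q' + 1)) (min (1 / (4 * Φ * τ * ι₁ + 1))
        (min (1 / (2 * (Φ * (exp 1 * τ * ι₁ + (exp 1 * τ) ^ 2 * ι₂' + (exp 1 * τ) ^ 3 * ι₃ + A' * (exp 1 * τ * Q') ^ 2 / 2)) + 1))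
          (min (A * Q ^ 3 / (16 * σ * Q' * A' * (4 * Q') ^ 3 + A * Q ^ 3))
            (A * Q ^ 3 / (16 * exp 1 * ψ * (2 * τ * ψ * Q') ^ 2 * Φ * τ ^ 2 * ι₁ ^ 2 + A * Q ^ 3))))))) * Real.log 4 / (2 * B * P.Klam + 1) →
      (∀ k, 1 ≤ k → k ≤ Kb → hubbardEffPartitionFnCT L M β U μ 0 K (klScale klE0 (d * k)) ≠ 0) ∧
      ∀ k, 2 ≤ k → k ≤ Kb → ∀ (t : Fin 5) (p : ℕ), 3 ≤ p → p ≤ D →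
        klTowerBLevF L M β U μ K d t k p ≤ A * (B * epsCoupling P U j) ^ (p - 1) * Q ^ p := by
  obtain ⟨C₁, C₂, hC₁, hC₂, h⟩ := klTowerBLevF_le_law_lev_of_doors_of_wgridStep_tok
  refine ⟨C₁, C₂, hC₁, hC₂, fun R hR2 => ?_⟩
  obtain ⟨c₃, hc₃, U₀, hU₀, h'⟩ := h R hR2
  refine ⟨c₃, hc₃, U₀, hU₀, ?_⟩
  intro P c hP hc hc6 hc₃' μ hμ U hU hU9 hU₀' β hβmin hβc K hK L M _ _ hL3 hM3 d Kb D hd hKbN hD cc n j hreg hj B hB jw κ hκ hGB αw hαw hrow hcol ρ hρ hθ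
    crw ccw hcrw hccw hrow' hcol' nV cF cg Ag Pg hnV hcF hcg hAg hPg ι₂ X hι₂ hX Ab Qb Ab' ι₂' X' hAb hQb hAb' hι₂' hX'
    κb αb crb ccb hκb hαb hcrb hccb κl αl hκl hκκb hααb hGBl hrowl hcoll hrowl' hcoll' hDl
    W Z σ Φ ψ τ ι₁ hW hZ hσ hΦ hψ hτ hι₁ ρk Q' Q κA Yb Y A A' ι₃ hρk hQ' hQ hκA hYb hY hA hA' hι₃ hblock hBle himp₁ himp₂ hcell hUdoor hcdoor
  have hβ : 0 < β := KLRegimeSplit.pos_of_klBetaMin_le hβmin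
  have hM0 : (0 : ℝ) < M := Nat.cast_pos.2 (Nat.pos_of_ne_zero (NeZero.ne M))
  have hε : 0 < imagTimeWeight β M := by unfold imagTimeWeight; positivity
  have hWpos : 0 < W := by rw [hW]; positivity
  have hZpos : 0 < Z := by rw [hZ]; positivity
  have hσnn : 0 ≤ σ := by rw [hσ]; positivity
  have hΦnn : 0 ≤ Φ := by rw [hΦ]; positivity
  have hψnn : 0 ≤ ψ := by rw [hψ]; positivity
  have hτpos : 0 < τ := by rw [hτ]; positivity
  -- the three discharges: tokenised floor step and Z-step from the link data, base value from the weighted grid step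
  have hstep := levLawF_hstep_of_blockBounds_tok hβ U μ K hd Kb hκb hαb hcrb hccb κl αl hκl hκκb hααb hGBl hrowl hcoll hrowl' hcoll'
    hDl hW hZ hσ hτ hψ hΦ
  have hZsucc := towerZ_succ_of_blockBounds hβ U μ K hd Kb hκb hαb hcrb hccb κl αl hκl hκκb hααb hGBl hrowl hcoll hrowl' hcoll'
    hDl hW hZ hσ hτ hψ hΦ
  have hZ1 : hubbardEffPartitionFnCT L M β U μ 0 K (klScale klE0 (d * 1)) ≠ 0 := by
    rw [Nat.mul_one]; exact hubbardEffPartitionFnCT_klScale_ne_zero_of_wgridStep hβ U μ K d hκ hGB hαw hrow hcol hρ hθ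
  exact h' P c hP hc hc6 hc₃' μ hμ U hU hU9 hU₀' β hβmin hβc K hK L M hL3 hM3 d Kb D hd hKbN hD cc n j hreg hj B hB jw κ hκ hGB αw hαw
    hrow hcol ρ hρ hθ crw ccw hcrw hccw hrow' hcol' nV cF cg Ag Pg hnV hcF hcg hAg hPg ι₂ X hι₂ hX Ab Qb Ab' ι₂' X' hAb hQb hAb' hι₂' hX'
    W Z σ Φ ψ τ ι₁ hWpos hZpos hσnn hΦnn hψnn hτpos hι₁ ρk Q' Q κA Yb Y A A' ι₃ hρk hQ' hQ hκA hYb hY hA hA' hι₃ hblock hBle himp₁ himp₂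
    hcell (fun k => hubbardEffPartitionFnCT L M β U μ 0 K (klScale klE0 (d * k)) ≠ 0) hZ1 hZsucc hstep hUdoor hcdoor

end Summit.HubbardSuperconductivity.HubbardSuperconductivity.Theorems.EngineV8

end
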